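import Mathlib
import Summits.ValiantsHypothesis.ValiantsHypothesis.Theorems.BarrierLeverPartitionMinorsHitByVPSimplexJoinBoxGameCubeTower
import Summits.ValiantsHypothesis.ValiantsHypothesis.Theorems.BarrierLeverPartitionMinorsHitByVPSimplexJoinBoxGameSquareDrainLayerCake

/-!
# Route BarrierLever — item `PartitionMinorsHitByVP` (stmt-ValiantsHypothesis-19717), line `hidden_states`:
# THE CUBE-DRAIN TOWER FOR THE SHARP (LAYER-CAKE) FLOOR

Helper file (`--supports stmt-ValiantsHypothesis-19717`; cell valiant-natproofs, rung V4, 𝒟-side door (c), line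
`Cruxes/PartitionMinorsHitByVP/Lines/hidden_states.lean` v8, registered stub `stub_simplexPairLower`; prover seat val-np-p3 gen 15).
Definition-free. Closes NO item. Twin of p667954 (`…BoxGameCubeTower`, crude floor) for the layer-cake floor of p656478 — the interface of
record of the line: for EVERY sharp-floor winning predicate `W`, every `t ≥ 1` and `k ≥ 1`, `k` column-disjoint binary `(t+1)`-cubes
(each in one piece) are dead whenever `r ≤ B_t(hd) + 2k − 2` and `hd ≥ 4k(t+1) + 8` (`not_boxWinning_cubes_tower_layerCake`).
Same induction (base `not_boxWinning_squares_drain_layerCake`, static zone `not_boxWinning_cubes_layerCake`, children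
`not_boxWinning_hypercube_layerCake`); the one new ingredient is the legality of the demand `r₁ = r − B_{t+1}(hd−1)` under the sharp floor:
THE LAYER-CAKE IDENTITY `Σ_{d ≤ t} B_d(n) + n·B_t(n−1) = (t+1)·B_{t+1}(n)` (`sum_balls_add`, i.e. `Σ_{d≤t}(B_{t+1} − B_d) = Σ_j j·C(n,j) =
n·B_t(n−1)`), whence at `r = B_{t+1}(hd) + x ≤ B_{t+2}(hd)` the layer-cake sum is `S(hd,r) = hd·B_t(hd−1) + (t+2)·x`
(`layerCake_le_head`, `layerCake_head_eq`) and `⌈S/hd⌉ ≤ B_t(hd−1) + x = r₁` because `t + 2 ≤ hd` — the ball chain is exactly as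
tight as the sharp floor allows.

WHAT THIS IS NOT: a necessary condition on winning predicates; item 19717 OPEN; nothing on crux 14610 or VP ≠ VNP.
-/

set_option linter.dupNamespace false

namespace Summit.ValiantsHypothesis.ValiantsHypothesis.Theorems.BarrierLever.SimplexJoin.Cut

open Finset Matrix
open Summit.ValiantsHypothesis.ValiantsHypothesis.Theorems.BarrierLever.HiddenStates

noncomputable section

/-! ## The layer-cake identity and the head of the layer cake -/

/-- The layer-cake identity (additive form): `Σ_{d ≤ t} B_d(n+1) + (n+1)·B_t(n) = (t+1)·B_{t+1}(n+1)`. -/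
theorem sum_balls_add (t n : ℕ) :
    (∑ d ∈ Finset.range (t + 1), ∑ j ∈ Finset.range (d + 1), (n + 1).choose j)
      + (n + 1) * (∑ j ∈ Finset.range (t + 1), n.choose j)
      = (t + 1) * ∑ j ∈ Finset.range (t + 2), (n + 1).choose j := by
  induction t with
  | zero => simp [Finset.sum_range_succ]
  | succ t ih =>
    rw [Finset.sum_range_succ (fun d => ∑ j ∈ Finset.range (d + 1), (n + 1).choose j) (t + 1),
      Finset.sum_range_succ (fun j => n.choose j) (t + 1), Nat.mul_add,
      Finset.sum_range_succ (fun j => (n + 1).choose j) (t + 2)]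
    have hc : (n + 1) * n.choose (t + 1) = (n + 1).choose (t + 2) * (t + 2) := Nat.add_one_mul_choose_eq n (t + 1)
    -- rearrange using ih
    have key : (∑ d ∈ Finset.range (t + 1), ∑ j ∈ Finset.range (d + 1), (n + 1).choose j)
        + (n + 1) * (∑ j ∈ Finset.range (t + 1), n.choose j)
        = (t + 1) * ∑ j ∈ Finset.range (t + 2), (n + 1).choose j := ih
    nlinarith [key, hc]

/-- Truncation: for `r ≤ B_{t+2}(hd)` (and `t + 2 ≤ hd`) the layer-cake sum has only its first `t+2` terms. -/
theorem layerCake_le_head (hd t r : ℕ) (ht : t + 2 ≤ hd) (hr : r ≤ ∑ j ∈ Finset.range (t + 3), hd.choose j) :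
    (∑ d ∈ Finset.range hd, (r - ∑ j ∈ Finset.range (d + 1), hd.choose j))
      ≤ ∑ d ∈ Finset.range (t + 2), (r - ∑ j ∈ Finset.range (d + 1), hd.choose j) := by
  have hterm : ∀ d ∈ Finset.range hd, (r - ∑ j ∈ Finset.range (d + 1), hd.choose j)
      ≤ if d < t + 2 then (r - ∑ j ∈ Finset.range (d + 1), hd.choose j) else 0 := by
    intro d _
    by_cases h2 : d < t + 2
    · rw [if_pos h2]
    · rw [if_neg h2]
      have hge : (∑ j ∈ Finset.range (t + 3), hd.choose j) ≤ ∑ j ∈ Finset.range (d + 1), hd.choose j :=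
        Finset.sum_le_sum_of_subset (Finset.range_subset_range.mpr (by omega))
      exact le_of_eq (Nat.sub_eq_zero_of_le (hr.trans hge))
  refine (Finset.sum_le_sum hterm).trans ?_
  rw [← Finset.sum_filter]
  have hfil : (Finset.range hd).filter (fun d => d < t + 2) = Finset.range (t + 2) := by
    ext d
    simp only [Finset.mem_filter, Finset.mem_range]
    omega
  rw [hfil]

/-- The head of the layer cake at `r = B_{t+1}(n+1) + x`: `Σ_{d ≤ t+1} (r − B_d(n+1)) = (n+1)·B_t(n) + (t+2)·x`. -/
theorem layerCake_head_eq (t n x : ℕ) :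
    (∑ d ∈ Finset.range (t + 2), ((∑ j ∈ Finset.range (t + 2), (n + 1).choose j) + x - ∑ j ∈ Finset.range (d + 1), (n + 1).choose j))
      = (n + 1) * (∑ j ∈ Finset.range (t + 1), n.choose j) + (t + 2) * x := by
  have hmono : ∀ d ∈ Finset.range (t + 2),
      (∑ j ∈ Finset.range (d + 1), (n + 1).choose j) ≤ ∑ j ∈ Finset.range (t + 2), (n + 1).choose j :=
    fun d hd => Finset.sum_le_sum_of_subset (Finset.range_subset_range.mpr (by rw [Finset.mem_range] at hd; omega))
  -- add Σ_d B_d to both sides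
  have h1 : (∑ d ∈ Finset.range (t + 2), ((∑ j ∈ Finset.range (t + 2), (n + 1).choose j) + x - ∑ j ∈ Finset.range (d + 1), (n + 1).choose j))
      + ∑ d ∈ Finset.range (t + 2), ∑ j ∈ Finset.range (d + 1), (n + 1).choose j
      = (t + 2) * ((∑ j ∈ Finset.range (t + 2), (n + 1).choose j) + x) := by
    rw [← Finset.sum_add_distrib, Finset.sum_congr rfl fun d hd => Nat.sub_add_cancel ((hmono d hd).trans (Nat.le_add_right _ _)),
      Finset.sum_const, Finset.card_range, smul_eq_mul]
  have h2 := sum_balls_add t n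
  rw [Finset.sum_range_succ (fun d => ∑ j ∈ Finset.range (d + 1), (n + 1).choose j) (t + 1)] at h1
  -- h1: LHS + (Σ_{d<t+1} B_d + B_{t+1}) = (t+2)(B_{t+1} + x); h2: Σ_{d<t+1} B_d + (n+1) B_t(n) = (t+1) B_{t+1}
  nlinarith [h1, h2]

/-! ## The tower, sharp floor -/

/-- **THE CUBE-DRAIN TOWER (layer-cake floor).** For every box-game winning predicate `W` of the SHARP floor (p656478), every `t ≥ 1` and `k ≥ 1`: a position
containing `k` column-disjoint binary `(t+1)`-cubes `i l : (Fin (t+1) → Fin 2) → Fin r` (each in one piece, slots reading one coordinate) is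
NOT a `W`-position whenever `r + 2 ≤ B_t(hd) + 2k` and `4k(t+1) + 8 ≤ hd`. -/
theorem not_boxWinning_cubes_tower_layerCake {m D N : ℕ}
    (W : (hd : ℕ) → (r : ℕ) → (Fin r → Fin m × (Fin D → Option (Fin N))) → Prop)
    (hwin : ∀ (hd r : ℕ) (e : Fin r → Fin m × (Fin D → Option (Fin N))), W hd r e → 2 ≤ r → 1 ≤ hd →
      ∀ r₀ r₁ : ℕ, r₀ + r₁ = r →
        (∑ d ∈ Finset.range hd, (r - ∑ j ∈ Finset.range (d + 1), hd.choose j) + hd - 1) / hd ≤ r₁ → r₁ ≤ r₀ →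
        r₀ ≤ 2 ^ (hd - 1) →
        ∃ (f : Fin m → Fin D) (side : Fin m → Option (Fin N) → Bool) (g₀ : Fin r₀ → Fin r) (g₁ : Fin r₁ → Fin r),
          Function.Injective (Sum.elim g₀ g₁) ∧
          (∀ j, side (e (g₀ j)).1 ((e (g₀ j)).2 (f (e (g₀ j)).1)) = false) ∧
          (∀ j, side (e (g₁ j)).1 ((e (g₁ j)).2 (f (e (g₁ j)).1)) = true) ∧
          W (hd - 1) r₀ (fun j => e (g₀ j)) ∧ W (hd - 1) r₁ (fun j => e (g₁ j))) :
    ∀ (t : ℕ), 1 ≤ t → ∀ (k : ℕ), 1 ≤ k →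
      ∀ (r hd : ℕ) (e : Fin r → Fin m × (Fin D → Option (Fin N))) (i : Fin k → (Fin (t + 1) → Fin 2) → Fin r),
      r + 2 ≤ (∑ j ∈ Finset.range (t + 1), hd.choose j) + 2 * k → 4 * k * (t + 1) + 8 ≤ hd →
      (Function.Injective fun lz : Fin k × (Fin (t + 1) → Fin 2) => i lz.1 lz.2) →
      (∀ l z, (e (i l z)).1 = (e (i l fun _ => 0)).1) →
      (∀ l (φ : Fin D), ∃ c : Fin (t + 1), ∀ z z', z c = z' c → (e (i l z)).2 φ = (e (i l z')).2 φ) →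
      ¬ W hd r e := by
  intro t
  induction t with
  | zero => intro ht; omega
  | succ t IHt =>
  intro _ k hk r hd e i hr hhd hinj hpiece hcb hW
  classical
  -- linear consequences of the (nonlinear) size hypothesis
  have hkt : 4 * k * (t + 1 + 1) = 4 * k * (t + 1) + 4 * k := by ring
  have hg8 : 8 * k ≤ 4 * k * (t + 1 + 1) := by nlinarith
  have hgt : t + 2 ≤ 4 * k * (t + 1 + 1) := by nlinarith
  have hP2 : 4 * k * (t + 1 + 1) = 2 * (2 * k * (t + 1 + 1)) := by ring
  have hP1 : 4 * k * (t + 1 + 1) = 2 * (2 * k * (t + 1)) + 4 * k := by ring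
  -- storey `t = 0`: squares — the square drain p666281
  by_cases ht0 : t = 0
  · subst ht0
    have hB1 : (∑ j ∈ Finset.range (0 + 1 + 1), hd.choose j) = 1 + hd := by simp [Finset.sum_range_succ]
    rw [hB1] at hr
    exact not_boxWinning_squares_drain_layerCake W hwin k hk r hd e i (by omega) (by omega) hinj hpiece hcb hW
  have IH := IHt (by omega)
  -- the static zone `r < B_{t+1}(hd) + k` is the multi-cube law
  by_cases hstatic : r < (∑ j ∈ Finset.range (t + 1 + 1), hd.choose j) + k
  · have hr2 : r ≤ ∑ j ∈ Finset.range (t + 1 + 2), hd.choose j := by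
      have hsplit : (∑ j ∈ Finset.range (t + 1 + 2), hd.choose j)
          = (∑ j ∈ Finset.range (t + 1 + 1), hd.choose j) + hd.choose (t + 1 + 1) :=
        Finset.sum_range_succ (fun j => hd.choose j) (t + 1 + 1)
      rw [hsplit]
      have hC : 2 * k ≤ hd.choose (t + 1 + 1) := by
        have h1 := le_choose_mul hd (t + 1) (by omega)
        by_contra hlt
        push Not at hlt
        have h2 : hd.choose (t + 1 + 1) * (t + 1 + 1) ≤ (2 * k - 1) * (t + 1 + 1) :=
          Nat.mul_le_mul_right _ (by omega)
        have h3 : (2 * k - 1) * (t + 1 + 1) + (t + 1 + 1) = 2 * k * (t + 1 + 1) := by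
          rw [← Nat.succ_mul]; congr 1; omega
        omega
      omega
    exact not_boxWinning_cubes_layerCake W hwin (t + 1) k hk r hd e i hstatic hr2 hinj hpiece hcb hW
  push Not at hstatic
  have hk2 : 2 ≤ k := by omega
  -- Pascal and the demand r₁ = r − B_{t+1}(hd−1)
  set B := ∑ j ∈ Finset.range (t + 1 + 1), (hd - 1).choose j with hB
  set B' := ∑ j ∈ Finset.range (t + 1), (hd - 1).choose j with hB'
  have hPas : (∑ j ∈ Finset.range (t + 1 + 1), hd.choose j) = B + B' := by
    have := ball_succ t (hd - 1)
    rw [show hd - 1 + 1 = hd by omega] at this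
    rw [hB, hB', this]
  have hBB' : B = B' + (hd - 1).choose (t + 1) := by rw [hB, hB', Finset.sum_range_succ]
  have hCbig : 2 * k ≤ (hd - 1).choose (t + 1) := by
    have h1 := le_choose_mul (hd - 1) t (by omega)
    by_contra hlt
    push Not at hlt
    have h2 : (hd - 1).choose (t + 1) * (t + 1) ≤ (2 * k - 1) * (t + 1) := Nat.mul_le_mul_right _ (by omega)
    have h3 : (2 * k - 1) * (t + 1) + (t + 1) = 2 * k * (t + 1) := by
      rw [← Nat.succ_mul]; congr 1; omega
    omega
  have hmean : (∑ j ∈ Finset.range (t + 1 + 1), hd.choose j) ≤ hd * B' + 1 := by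
    have := ball_le_mul t (hd - 1)
    rw [show hd - 1 + 1 = hd by omega] at this
    rw [hB']; exact this
  have hBpow : B ≤ 2 ^ (hd - 1) := by rw [hB]; exact ball_le_two_pow (t + 1) (hd - 1)
  have hB'pos : 1 ≤ B' := by
    rw [hB', Finset.sum_range_succ']
    simp
  set r₁ := r - B with hr₁
  have hr₁lo : B' + k ≤ r₁ := by omega
  have hr₁hi : r₁ + 2 ≤ B' + 2 * k := by omega
  have hsum : B + r₁ = r := by omega
  have hfloor : (∑ d ∈ Finset.range hd, (r - ∑ j ∈ Finset.range (d + 1), hd.choose j) + hd - 1) / hd ≤ r₁ := by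
    -- truncation: only the first t+2 terms survive (r ≤ B_{t+2}(hd))
    have hC2 : 2 * k ≤ hd.choose (t + 1 + 1) := by
      have h1 := le_choose_mul hd (t + 1) (by omega)
      by_contra hlt
      push Not at hlt
      have h2 : hd.choose (t + 1 + 1) * (t + 1 + 1) ≤ (2 * k - 1) * (t + 1 + 1) :=
        Nat.mul_le_mul_right _ (by omega)
      have h3 : (2 * k - 1) * (t + 1 + 1) + (t + 1 + 1) = 2 * k * (t + 1 + 1) := by
        rw [← Nat.succ_mul]; congr 1; omega
      omega
    have hrB2 : r ≤ ∑ j ∈ Finset.range (t + 3), hd.choose j := by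
      have hsplit : (∑ j ∈ Finset.range (t + 3), hd.choose j)
          = (∑ j ∈ Finset.range (t + 1 + 1), hd.choose j) + hd.choose (t + 1 + 1) :=
        Finset.sum_range_succ (fun j => hd.choose j) (t + 1 + 1)
      rw [hsplit]; omega
    have hS1 := layerCake_le_head hd t r (by omega) hrB2
    -- the head at r = B_{t+1}(hd) + x
    set x := r - ∑ j ∈ Finset.range (t + 1 + 1), hd.choose j with hx
    have hrx : r = (∑ j ∈ Finset.range (t + 1 + 1), hd.choose j) + x := by omega
    have hS2 := layerCake_head_eq t (hd - 1) x
    rw [show hd - 1 + 1 = hd by omega] at hS2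
    have hS : (∑ d ∈ Finset.range hd, (r - ∑ j ∈ Finset.range (d + 1), hd.choose j)) ≤ hd * B' + (t + 2) * x := by
      rw [hB']
      calc (∑ d ∈ Finset.range hd, (r - ∑ j ∈ Finset.range (d + 1), hd.choose j))
          ≤ ∑ d ∈ Finset.range (t + 2), (r - ∑ j ∈ Finset.range (d + 1), hd.choose j) := hS1
        _ = hd * (∑ j ∈ Finset.range (t + 1), (hd - 1).choose j) + (t + 2) * x := by rw [hrx]; exact hS2
    have hx1 : r₁ = B' + x := by omega
    have htx : (t + 2) * x ≤ hd * x := Nat.mul_le_mul_right _ (by omega)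
    rw [Nat.div_le_iff_le_mul_add_pred (by omega), hx1]
    have hdist : hd * (B' + x) = hd * B' + hd * x := by ring
    rw [hdist]
    omega
  obtain ⟨f, side, g₀, g₁, hg, hfalse, htrue, hW0, hW1⟩ :=
    hwin hd r e hW (by omega) (by omega) B r₁ hsum hfloor (by omega) hBpow
  set col : Fin r → Bool := fun x => side (e x).1 ((e x).2 (f (e x).1)) with hcol
  have hsurj : Function.Surjective (Sum.elim g₀ g₁) := by
    have hbij := (Fintype.bijective_iff_injective_and_card _).mpr
      ⟨hg, by simp [Fintype.card_sum, Fintype.card_fin]; omega⟩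
    exact hbij.2
  have hg₀inj : Function.Injective g₀ := fun a b h => Sum.inl_injective (hg (by simpa using h))
  have hg₁inj : Function.Injective g₁ := fun a b h => Sum.inr_injective (hg (by simpa using h))
  have hfalse_pre : ∀ x, col x = false → ∃ j, g₀ j = x := by
    intro x hx
    obtain ⟨s, hs⟩ := hsurj x
    rcases s with j | j
    · exact ⟨j, hs⟩
    · have : col x = true := by rw [← hs]; exact htrue j
      rw [hx] at this; exact absurd this (by decide)
  have htrue_pre : ∀ x, col x = true → ∃ j, g₁ j = x := by
    intro x hx
    obtain ⟨s, hs⟩ := hsurj x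
    rcases s with j | j
    · have : col x = false := by rw [← hs]; exact hfalse j
      rw [hx] at this; exact absurd this (by decide)
    · exact ⟨j, hs⟩
  -- the colour of a cube column depends on one coordinate
  choose c hc using hcb
  have hcolour : ∀ l (z z' : Fin (t + 2) → Fin 2), z (c l (f (e (i l fun _ => 0)).1)) = z' (c l (f (e (i l fun _ => 0)).1)) →
      col (i l z) = col (i l z') := by
    intro l z z' hzz
    have hslot := hc l (f (e (i l fun _ => 0)).1) z z' hzz
    simp only [hcol, hpiece l z, hpiece l z', hslot]
  -- the two static laws available in the children
  have hchild0 : ∀ (i' : (Fin (t + 2) → Fin 2) → Fin B), Function.Injective i' →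
      (∀ z, (e (g₀ (i' z))).1 = (e (g₀ (i' fun _ => 0))).1) →
      (∀ φ : Fin D, ∃ c' : Fin (t + 2), ∀ z z', z c' = z' c' → (e (g₀ (i' z))).2 φ = (e (g₀ (i' z'))).2 φ) → False := by
    intro i' hi' hp' hc'
    exact not_boxWinning_hypercube_layerCake W hwin (t + 1) B (hd - 1) (fun x => e (g₀ x)) i' (by rw [hB]) hi' hp' hc' hW0
  have hchild1cube : ∀ (i' : (Fin (t + 2) → Fin 2) → Fin r₁), Function.Injective i' →
      (∀ z, (e (g₁ (i' z))).1 = (e (g₁ (i' fun _ => 0))).1) →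
      (∀ φ : Fin D, ∃ c' : Fin (t + 2), ∀ z z', z c' = z' c' → (e (g₁ (i' z))).2 φ = (e (g₁ (i' z'))).2 φ) → False := by
    intro i' hi' hp' hc'
    exact not_boxWinning_hypercube_layerCake W hwin (t + 1) r₁ (hd - 1) (fun x => e (g₁ x)) i' (by rw [← hB]; omega) hi' hp' hc' hW1
  -- Case 1: some cube is monochromatic ⇒ it survives whole in one child
  by_cases hmono : ∃ l, col (i l fun _ => 0) = col (i l fun _ => 1)
  · obtain ⟨l, hl⟩ := hmono
    have hall : ∀ z, col (i l z) = col (i l fun _ => 0) := by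
      intro z
      rcases Fin.exists_fin_two.mp ⟨z (c l (f (e (i l fun _ => 0)).1)), rfl⟩ with h0 | h1
      · exact hcolour l z (fun _ => 0) h0
      · rw [hl]; exact hcolour l z (fun _ => 1) h1
    cases hc0 : col (i l fun _ => 0) with
    | false =>
      have hpre : ∀ z, ∃ j, g₀ j = i l z := fun z => hfalse_pre _ (by rw [hall z, hc0])
      choose j hj using hpre
      refine hchild0 j (fun z z' h => ?_) (fun z => by simp only [hj]; exact hpiece l z) (fun φ => ?_)
      · have := congrArg g₀ h
        rw [hj, hj] at this
        exact (Prod.ext_iff.mp (hinj (a₁ := (l, z)) (a₂ := (l, z')) this)).2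
      · refine ⟨c l φ, fun z z' hzz => ?_⟩
        simp only [hj]; exact hc l φ z z' hzz
    | true =>
      have hpre : ∀ z, ∃ j, g₁ j = i l z := fun z => htrue_pre _ (by rw [hall z, hc0])
      choose j hj using hpre
      refine hchild1cube j (fun z z' h => ?_) (fun z => by simp only [hj]; exact hpiece l z) (fun φ => ?_)
      · have := congrArg g₁ h
        rw [hj, hj] at this
        exact (Prod.ext_iff.mp (hinj (a₁ := (l, z)) (a₂ := (l, z')) this)).2
      · refine ⟨c l φ, fun z z' hzz => ?_⟩
        simp only [hj]; exact hc l φ z z' hzz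
  -- Case 2: every cube splits; its `true` half is a `(t+1)`-cube in the small child
  push Not at hmono
  -- the `true` bit of cube `l`
  have hbit : ∀ l, ∃ b : Fin 2, col (i l fun _ => b) = true := by
    intro l
    cases h0 : col (i l fun _ => 0) with
    | true => exact ⟨0, h0⟩
    | false =>
      refine ⟨1, ?_⟩
      cases h1 : col (i l fun _ => 1) with
      | true => rfl
      | false => exact absurd (h0.trans h1.symm) (hmono l)
  choose b hb using hbit
  -- the half-cube: coordinate `c₀ l` frozen at `b l`
  let c₀ : Fin k → Fin (t + 2) := fun l => c l (f (e (i l fun _ => 0)).1)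
  let sq : Fin k → (Fin (t + 1) → Fin 2) → (Fin (t + 2) → Fin 2) := fun l z' =>
    Fin.insertNth (α := fun _ => Fin 2) (c₀ l) (b l) z'
  have hsq_true : ∀ l z', col (i l (sq l z')) = true := by
    intro l z'
    have h1 : (sq l z') (c₀ l) = (fun _ : Fin (t + 2) => b l) (c₀ l) := by
      simp only [sq, Fin.insertNth_apply_same]
    rw [hcolour l (sq l z') (fun _ => b l) h1]
    exact hb l
  have hpre : ∀ l z', ∃ j, g₁ j = i l (sq l z') := fun l z' => htrue_pre _ (hsq_true l z')
  choose j hj using hpre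
  refine IH k hk r₁ (hd - 1) (fun x => e (g₁ x)) j (by omega) (by omega) ?_ ?_ ?_ hW1
  · rintro ⟨l, z⟩ ⟨l', z'⟩ h
    have h' : i l (sq l z) = i l' (sq l' z') := by
      have := congrArg g₁ h
      simpa only [hj] using this
    have hll := hinj (a₁ := (l, sq l z)) (a₂ := (l', sq l' z')) h'
    simp only [Prod.mk.injEq] at hll
    obtain ⟨rfl, hzz⟩ := hll
    have hzz' : Fin.insertNth (α := fun _ => Fin 2) (c₀ l) (b l) z = Fin.insertNth (α := fun _ => Fin 2) (c₀ l) (b l) z' := hzz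
    have : z = z' := Fin.insertNth_right_injective (α := fun _ => Fin 2) (p := c₀ l) (b l) hzz'
    rw [this]
  · intro l z'
    simp only [hj]
    rw [hpiece l (sq l z'), hpiece l (sq l fun _ => 0)]
  · intro l φ
    by_cases hφ : c l φ = c₀ l
    · -- the slot reads the frozen coordinate: constant on the square
      refine ⟨0, fun z z' _ => ?_⟩
      simp only [hj]
      refine hc l φ _ _ ?_
      rw [hφ]
      simp only [sq, Fin.insertNth_apply_same]
    · obtain ⟨c', hc'⟩ := Fin.exists_succAbove_eq hφ
      refine ⟨c', fun z z' hzz => ?_⟩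
      simp only [hj]
      refine hc l φ _ _ ?_
      rw [← hc']
      simp only [sq, Fin.insertNth_apply_succAbove]
      exact hzz



end

end Summit.ValiantsHypothesis.ValiantsHypothesis.Theorems.BarrierLever.SimplexJoin.Cut
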